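import Summits.NavierStokesRegularity.FluidComputer.HomSobolevLadder
import Summits.NavierStokesRegularity.FluidComputer.SerrinFaceQuantitative
import HarnessLib

/-!
# Fluid computer — the SOBOLEV LADDER, time-integrated (L51-S / L52-S): every Sobolev–Serrin class
# `L^{4/(2s−1)}_t Ḃ^s_{2,1}` / `L^{4/(2s−1)}_t Ḣ^s_x` is left on every terminal window, with logarithmic floors

HONEST FRAMING (cell `pub-fluidc`, verbatim): *low prior, high value-of-information experiment on Tao's
machine paradigm; NOT a claim that NS blows up.* Theorem side of the cell; nothing here is evidence of blow-up.

The ladder clocks (L51 `SobolevLadder.ladder_clock`, `Ḃ^s_{2,1}` currency, `s ∈ (1/2, 3/2]`; L52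
`HomSobolevLadder.homSobolev_clock`, `Ḣ^s` currency, `s ∈ (1/2, 3/2)`) bound the `s`-row at every instant by
`c_s ν^{(5−2s)/4} (T − t)^{−(2s−1)/4}`. Raised to the SCALING EXPONENT `q_s = 4/(2s − 1)` (the one with
`2/q_s = s − 1/2`, i.e. the time exponent making `L^{q}_t Ḣ^s_x` invariant under the Navier–Stokes scaling) the
right-hand side is `∝ (T − t)^{−1}`, which is not integrable at `T`; as in gen 15's `SerrinFaceQuantitative` (the
cases `s = 3/2`: `∫‖u‖_∞²`, and `s = 1`: `∫ Z²`) this gives, along every maximal smooth Leray–Hopf solution of the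
unforced Navier–Stokes system on `ℝ³` (`ν > 0`):

* `log_le_lintegral_rpow_of_clock`, `lintegral_rpow_eq_top_of_clock` — the bookkeeping: a clock
  `c ν^a (T − τ)^{−b} ≤ X(τ)` on `(t₀, t)` forces `(c ν^a)^{1/b} log((T − t₀)/(T − t)) ≤ ∫_{(t₀,t)} X^{1/b}` and
  `∫_{(t₀,T)} X^{1/b} = ∞`;
* `ladder_log_floor` / `ladder_lintegral_eq_top` (**L51-S**) — for `s ∈ (1/2, 3/2]` and all `0 ≤ t₀ ≤ t < T`:
  `c ν^{(5−2s)/(2s−1)} log((T − t₀)/(T − t)) ≤ ∫_{(t₀,t)} (∑_j 2^{sj} ‖Δ̇_j u(τ)‖₂)^{4/(2s−1)} dτ`, and the integral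
  over every terminal window `(t₀, T)` is `∞`;
* `homSobolev_log_floor` / `homSobolev_lintegral_eq_top` (**L52-S**) — the same for `‖u(τ)‖_{Ḣ^s}`,
  `s ∈ (1/2, 3/2)`: `u ∉ L^{4/(2s−1)}(t₀, T; Ḣ^s)` for every `t₀ < T` — by the embedding
  `Ḣ^s ⊂ L^{6/(3−2s)}` this is the Prodi–Serrin scale `2/q + 3/r = 1` read in Sobolev currency, every rung of it,
  with the running integral growing at least logarithmically.

Reading for the atlas. The time-integrated rows are the robust ones for a sampled run: for each `s`, the running
integral `∫_{t₀}^{t} (∑_k |k|^{2s}E(k,τ))^{2/(2s−1)} dτ` must grow at least like `log(1/(T − t))` into a realised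
blow-up — at `s = 1` this is `∫ Z²` (L30‴), at `s → 3/2` it approaches `∫ ‖u‖_∞²`. HONEST SIZE NOTE: constants
inexplicit and `s`-dependent (`c_s^{4/(2s−1)}`, degenerating at both ends of the range); logarithmic floors are
the weakest possible divergence; class = `ℝ³` finite energy. Words and shapes for the writer, never numbers at the
cell's levels. Necessity only; nothing about sufficiency. 0 sorry; no new definitions, no named facts.

## References

* G. Prodi, Ann. Mat. Pura Appl. 48 (1959) 173–182; J. Serrin, Arch. Ration. Mech. Anal. 9 (1962) 187–195.
  [Prodi1959]
* J. C. Robinson, W. Sadowski, Rend. Semin. Mat. Univ. Padova 131 (2014) 159–178, Corollaries 9–10.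
  [RobinsonSadowski2014]
* J. Leray, Acta Math. 63 (1934), §22 p. 227. [Leray1934]
-/

noncomputable section

open MeasureTheory Set Function Filter Topology Metric
open scoped ENNReal NNReal
open Literature.Analysis.FluidPDE Literature.Analysis.FunctionSpaces
open Summit.NavierStokesRegularity.FluidComputer.SobolevLadder
open Summit.NavierStokesRegularity.FluidComputer.HomSobolevLadder

namespace Summit.NavierStokesRegularity.FluidComputer.SobolevLadderSerrin

/-! ## Bookkeeping: a clock raised to the scaling exponent is not integrable at `T` -/

/-- **Pointwise**: if `ofReal (c ν^a (T − τ)^{−b}) ≤ X` with `c, ν, b > 0` and `τ < T`, then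
`ofReal ((c ν^a)^{1/b}) · ofReal ((T − τ)⁻¹) ≤ X^{1/b}`. [folklore] -/
theorem rpow_clock_pointwise {c ν a b T τ : ℝ} (hc : 0 < c) (hν : 0 < ν) (hb : 0 < b) (hτ : τ < T)
    {X : ℝ≥0∞} (h : ENNReal.ofReal (c * ν ^ a * (T - τ) ^ (-b)) ≤ X) :
    ENNReal.ofReal ((c * ν ^ a) ^ (1 / b)) * ENNReal.ofReal ((T - τ)⁻¹) ≤ X ^ (1 / b) := by
  have hTτ : 0 < T - τ := sub_pos.2 hτ
  have hca : 0 < c * ν ^ a := by positivity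
  have h1 : ENNReal.ofReal (c * ν ^ a * (T - τ) ^ (-b)) ^ (1 / b) ≤ X ^ (1 / b) :=
    ENNReal.rpow_le_rpow h (by positivity)
  refine le_trans (le_of_eq ?_) h1
  rw [← ENNReal.ofReal_mul (by positivity),
    ENNReal.ofReal_rpow_of_nonneg (by positivity) (by positivity)]
  congr 1
  rw [Real.mul_rpow hca.le (Real.rpow_nonneg hTτ.le _), ← Real.rpow_mul hTτ.le,
    show -b * (1 / b) = -1 by field_simp, Real.rpow_neg_one]

/-- **The running integral of `X^{1/b}` has a logarithmic floor**: a clock `ofReal (c ν^a (T − τ)^{−b}) ≤ X(τ)` on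
`(t₀, t)` (`c, ν, b > 0`, `t₀ ≤ t < T`) gives `ofReal ((c ν^a)^{1/b} log((T − t₀)/(T − t))) ≤ ∫⁻_{(t₀,t)} X^{1/b}`
(`SerrinFaceQuantitative.lintegral_inv_sub_eq_log`). [folklore] -/
theorem log_le_lintegral_rpow_of_clock {c ν a b T t₀ t : ℝ} (hc : 0 < c) (hν : 0 < ν) (hb : 0 < b)
    (h₀ : t₀ ≤ t) (ht : t < T) {X : ℝ → ℝ≥0∞}
    (hclock : ∀ τ ∈ Ioo t₀ t, ENNReal.ofReal (c * ν ^ a * (T - τ) ^ (-b)) ≤ X τ) :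
    ENNReal.ofReal ((c * ν ^ a) ^ (1 / b) * Real.log ((T - t₀) / (T - t))) ≤
      ∫⁻ τ in Ioo t₀ t, X τ ^ (1 / b) := by
  have hK : 0 ≤ (c * ν ^ a) ^ (1 / b) := by positivity
  calc ENNReal.ofReal ((c * ν ^ a) ^ (1 / b) * Real.log ((T - t₀) / (T - t)))
      = ENNReal.ofReal ((c * ν ^ a) ^ (1 / b)) * ENNReal.ofReal (Real.log ((T - t₀) / (T - t))) :=
        ENNReal.ofReal_mul hK
    _ = ENNReal.ofReal ((c * ν ^ a) ^ (1 / b)) * ∫⁻ τ in Ioo t₀ t, ENNReal.ofReal ((T - τ)⁻¹) := by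
        rw [SerrinFaceQuantitative.lintegral_inv_sub_eq_log h₀ ht]
    _ = ∫⁻ τ in Ioo t₀ t, ENNReal.ofReal ((c * ν ^ a) ^ (1 / b)) * ENNReal.ofReal ((T - τ)⁻¹) :=
        (lintegral_const_mul' _ _ ENNReal.ofReal_ne_top).symm
    _ ≤ ∫⁻ τ in Ioo t₀ t, X τ ^ (1 / b) :=
        setLIntegral_mono' measurableSet_Ioo fun τ hτ =>
          rpow_clock_pointwise hc hν hb (hτ.2.trans ht) (hclock τ hτ)

/-- **The integral of `X^{1/b}` over a terminal window is infinite**: a clock `ofReal (c ν^a (T − τ)^{−b}) ≤ X(τ)`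
on `(t₀, T)` (`c, ν, b > 0`, `t₀ < T`) gives `∫⁻_{(t₀,T)} X^{1/b} = ∞` (`SerrinFace.lintegral_inv_sub_eq_top`).
[folklore] -/
theorem lintegral_rpow_eq_top_of_clock {c ν a b T t₀ : ℝ} (hc : 0 < c) (hν : 0 < ν) (hb : 0 < b)
    (ht₀ : t₀ < T) {X : ℝ → ℝ≥0∞}
    (hclock : ∀ τ ∈ Ioo t₀ T, ENNReal.ofReal (c * ν ^ a * (T - τ) ^ (-b)) ≤ X τ) :
    ∫⁻ τ in Ioo t₀ T, X τ ^ (1 / b) = ∞ := by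
  have hK : 0 < (c * ν ^ a) ^ (1 / b) := by positivity
  refine eq_top_iff.2 ?_
  calc (⊤ : ℝ≥0∞) = ENNReal.ofReal ((c * ν ^ a) ^ (1 / b)) * ∫⁻ τ in Ioo t₀ T, ENNReal.ofReal ((T - τ)⁻¹) := by
        rw [SerrinFace.lintegral_inv_sub_eq_top ht₀, ENNReal.mul_top (ENNReal.ofReal_pos.2 hK).ne']
    _ = ∫⁻ τ in Ioo t₀ T, ENNReal.ofReal ((c * ν ^ a) ^ (1 / b)) * ENNReal.ofReal ((T - τ)⁻¹) :=
        (lintegral_const_mul' _ _ ENNReal.ofReal_ne_top).symm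
    _ ≤ ∫⁻ τ in Ioo t₀ T, X τ ^ (1 / b) :=
        setLIntegral_mono' measurableSet_Ioo fun τ hτ => rpow_clock_pointwise hc hν hb hτ.2 (hclock τ hτ)

/-- Exponent bookkeeping for the ladder: with `a = (5 − 2s)/4`, `b = (2s − 1)/4` (`s > 1/2`), `1/b = 4/(2s − 1)`
and `(c ν^a)^{1/b} = c^{4/(2s−1)} ν^{(5−2s)/(2s−1)}`. [folklore] -/
theorem ladder_exponents {c ν s : ℝ} (hc : 0 < c) (hν : 0 < ν) (hs : 1 / 2 < s) :
    1 / ((2 * s - 1) / 4) = 4 / (2 * s - 1) ∧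
      (c * ν ^ ((5 - 2 * s) / 4)) ^ (4 / (2 * s - 1)) =
        c ^ (4 / (2 * s - 1)) * ν ^ ((5 - 2 * s) / (2 * s - 1)) := by
  have hb : 0 < 2 * s - 1 := by linarith
  have e : 1 / ((2 * s - 1) / 4) = 4 / (2 * s - 1) := by field_simp
  refine ⟨e, ?_⟩
  rw [Real.mul_rpow hc.le (Real.rpow_nonneg hν.le _), ← Real.rpow_mul hν.le]
  congr 2
  field_simp

/-! ## L51-S: the `Ḃ^s_{2,1}` rows, time-integrated -/

/-- **L51-S — LOGARITHMIC FLOOR OF THE RUNNING `L^{4/(2s−1)}_t Ḃ^s_{2,1}` INTEGRAL.** For every `s ∈ (1/2, 3/2]`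
there is `c > 0` such that along every maximal smooth solution `(u, p)` of the unforced Navier–Stokes system on
`ℝ³ × [0, T)` (`ν > 0`) which is Leray–Hopf from `u 0`, for all `0 ≤ t₀ ≤ t < T`:
`c · ν^{(5−2s)/(2s−1)} · log((T − t₀)/(T − t)) ≤ ∫⁻_{(t₀,t)} (∑_j 2^{sj} ‖Δ̇_j u(τ)‖₂)^{4/(2s−1)} dτ`
(`SobolevLadder.ladder_clock` raised to the scaling exponent `4/(2s−1)`). [cite: Prodi1959]
[cite: RobinsonSadowski2014, Corollary 10] [cite: Leray1934, §22 p. 227] -/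
theorem ladder_log_floor (s : ℝ) (hs : s ∈ Ioc (1 / 2 : ℝ) (3 / 2)) :
    ∃ c : ℝ, 0 < c ∧ ∀ (ν T : ℝ), 0 < ν → 0 < T →
      ∀ (u : ℝ → EuclideanSpace ℝ (Fin 3) → EuclideanSpace ℝ (Fin 3)) (p : ℝ → EuclideanSpace ℝ (Fin 3) → ℝ),
      IsMaximalSmoothSolution ν 0 u p T → IsLerayHopfOn T ν 0 (u 0) u →
      ∀ t₀ t : ℝ, 0 ≤ t₀ → t₀ ≤ t → t < T →
        ENNReal.ofReal (c * ν ^ ((5 - 2 * s) / (2 * s - 1)) * Real.log ((T - t₀) / (T - t))) ≤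
          ∫⁻ τ in Ioo t₀ t, (∑' j : ℤ, (2 : ℝ≥0∞) ^ (s * (j : ℝ)) * blockL2 (u τ) j) ^ (4 / (2 * s - 1)) := by
  obtain ⟨c, hc, H⟩ := ladder_clock s hs
  have hb : 0 < (2 * s - 1) / 4 := by linarith [hs.1]
  refine ⟨c ^ (4 / (2 * s - 1)), by positivity, fun ν T hν hT u p hmax hLH t₀ t ht₀ h₀ ht => ?_⟩
  obtain ⟨e1, e2⟩ := ladder_exponents (c := c) (ν := ν) hc hν hs.1
  have h := log_le_lintegral_rpow_of_clock (a := (5 - 2 * s) / 4) (T := T) hc hν hb h₀ ht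
    (X := fun τ => ∑' j : ℤ, (2 : ℝ≥0∞) ^ (s * (j : ℝ)) * blockL2 (u τ) j)
    (fun τ hτ => H ν T hν hT u p hmax hLH τ ⟨ht₀.trans_lt hτ.1, hτ.2.trans ht⟩)
  rw [e1, e2, mul_assoc] at h
  rw [mul_assoc]
  exact h

/-- **L51-S — EVERY `L^{4/(2s−1)}_t Ḃ^s_{2,1}` INTEGRAL OVER A TERMINAL WINDOW DIVERGES**, `s ∈ (1/2, 3/2]`: along
every maximal smooth Leray–Hopf solution of the unforced system (`ν > 0`), for every `t₀ ∈ [0, T)`: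
`∫⁻_{(t₀,T)} (∑_j 2^{sj} ‖Δ̇_j u(τ)‖₂)^{4/(2s−1)} dτ = ∞`. At `s = 1` compare `∫ Z² = ∞` (L30‴), at `s = 3/2`
`∫ ‖u‖_∞² = ∞` (L30). [cite: Prodi1959] [cite: RobinsonSadowski2014, Corollary 10] -/
theorem ladder_lintegral_eq_top (s : ℝ) (hs : s ∈ Ioc (1 / 2 : ℝ) (3 / 2)) {ν T : ℝ} (hν : 0 < ν) (hT : 0 < T)
    {u : ℝ → EuclideanSpace ℝ (Fin 3) → EuclideanSpace ℝ (Fin 3)} {p : ℝ → EuclideanSpace ℝ (Fin 3) → ℝ}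
    (hmax : IsMaximalSmoothSolution ν 0 u p T) (hLH : IsLerayHopfOn T ν 0 (u 0) u)
    {t₀ : ℝ} (ht₀ : t₀ ∈ Ico 0 T) :
    ∫⁻ τ in Ioo t₀ T, (∑' j : ℤ, (2 : ℝ≥0∞) ^ (s * (j : ℝ)) * blockL2 (u τ) j) ^ (4 / (2 * s - 1)) = ∞ := by
  obtain ⟨c, hc, H⟩ := ladder_clock s hs
  have hb : 0 < (2 * s - 1) / 4 := by linarith [hs.1]
  have e1 : 1 / ((2 * s - 1) / 4) = 4 / (2 * s - 1) := by field_simp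
  have h := lintegral_rpow_eq_top_of_clock (a := (5 - 2 * s) / 4) hc hν hb ht₀.2
    (X := fun τ => ∑' j : ℤ, (2 : ℝ≥0∞) ^ (s * (j : ℝ)) * blockL2 (u τ) j)
    (fun τ hτ => H ν T hν hT u p hmax hLH τ ⟨ht₀.1.trans_lt hτ.1, hτ.2⟩)
  rw [e1] at h
  exact h

/-! ## L52-S: the `Ḣ^s` rows, time-integrated -/

/-- **L52-S — LOGARITHMIC FLOOR OF THE RUNNING `L^{4/(2s−1)}_t Ḣ^s_x` INTEGRAL.** For every `s ∈ (1/2, 3/2)` there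
is `c > 0` such that along every maximal smooth Leray–Hopf solution of the unforced system (`ν > 0`), for all
`0 ≤ t₀ ≤ t < T`: `c · ν^{(5−2s)/(2s−1)} · log((T − t₀)/(T − t)) ≤ ∫⁻_{(t₀,t)} ‖u(τ)‖_{Ḣ^s}^{4/(2s−1)} dτ`
(`HomSobolevLadder.homSobolev_clock` raised to the scaling exponent; `2/q + 3/r = 1` with `q = 4/(2s−1)`,
`r = 6/(3−2s)` — the Prodi–Serrin scale in Sobolev currency). [cite: Prodi1959]
[cite: RobinsonSadowski2014, Corollary 10] [cite: Leray1934, §22 p. 227] -/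
theorem homSobolev_log_floor (s : ℝ) (hs : s ∈ Ioo (1 / 2 : ℝ) (3 / 2)) :
    ∃ c : ℝ, 0 < c ∧ ∀ (ν T : ℝ), 0 < ν → 0 < T →
      ∀ (u : ℝ → EuclideanSpace ℝ (Fin 3) → EuclideanSpace ℝ (Fin 3)) (p : ℝ → EuclideanSpace ℝ (Fin 3) → ℝ),
      IsMaximalSmoothSolution ν 0 u p T → IsLerayHopfOn T ν 0 (u 0) u →
      ∀ t₀ t : ℝ, 0 ≤ t₀ → t₀ ≤ t → t < T →
        ENNReal.ofReal (c * ν ^ ((5 - 2 * s) / (2 * s - 1)) * Real.log ((T - t₀) / (T - t))) ≤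
          ∫⁻ τ in Ioo t₀ t,
            Function.eHomSobolevSeminorm s (EuclideanSpace.complexify ∘ u τ) ^ (4 / (2 * s - 1)) := by
  obtain ⟨c, hc, H⟩ := homSobolev_clock s hs
  have hb : 0 < (2 * s - 1) / 4 := by linarith [hs.1]
  refine ⟨c ^ (4 / (2 * s - 1)), by positivity, fun ν T hν hT u p hmax hLH t₀ t ht₀ h₀ ht => ?_⟩
  obtain ⟨e1, e2⟩ := ladder_exponents (c := c) (ν := ν) hc hν hs.1
  have h := log_le_lintegral_rpow_of_clock (a := (5 - 2 * s) / 4) (T := T) hc hν hb h₀ ht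
    (X := fun τ => Function.eHomSobolevSeminorm s (EuclideanSpace.complexify ∘ u τ))
    (fun τ hτ => H ν T hν hT u p hmax hLH τ ⟨ht₀.trans_lt hτ.1, hτ.2.trans ht⟩)
  rw [e1, e2, mul_assoc] at h
  rw [mul_assoc]
  exact h

/-- **L52-S — `u ∉ L^{4/(2s−1)}(t₀, T; Ḣ^s)` ON EVERY TERMINAL WINDOW**, `s ∈ (1/2, 3/2)`: along every maximal smooth
Leray–Hopf solution of the unforced system (`ν > 0`), for every `t₀ ∈ [0, T)`:
`∫⁻_{(t₀,T)} ‖u(τ)‖_{Ḣ^s}^{4/(2s−1)} dτ = ∞` — every rung of the Sobolev–Serrin scale diverges.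
[cite: Prodi1959] [cite: RobinsonSadowski2014, Corollary 10] -/
theorem homSobolev_lintegral_eq_top (s : ℝ) (hs : s ∈ Ioo (1 / 2 : ℝ) (3 / 2)) {ν T : ℝ} (hν : 0 < ν)
    (hT : 0 < T) {u : ℝ → EuclideanSpace ℝ (Fin 3) → EuclideanSpace ℝ (Fin 3)}
    {p : ℝ → EuclideanSpace ℝ (Fin 3) → ℝ}
    (hmax : IsMaximalSmoothSolution ν 0 u p T) (hLH : IsLerayHopfOn T ν 0 (u 0) u)
    {t₀ : ℝ} (ht₀ : t₀ ∈ Ico 0 T) :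
    ∫⁻ τ in Ioo t₀ T, Function.eHomSobolevSeminorm s (EuclideanSpace.complexify ∘ u τ) ^ (4 / (2 * s - 1)) = ∞ := by
  obtain ⟨c, hc, H⟩ := homSobolev_clock s hs
  have hb : 0 < (2 * s - 1) / 4 := by linarith [hs.1]
  have e1 : 1 / ((2 * s - 1) / 4) = 4 / (2 * s - 1) := by field_simp
  have h := lintegral_rpow_eq_top_of_clock (a := (5 - 2 * s) / 4) hc hν hb ht₀.2
    (X := fun τ => Function.eHomSobolevSeminorm s (EuclideanSpace.complexify ∘ u τ))
    (fun τ hτ => H ν T hν hT u p hmax hLH τ ⟨ht₀.1.trans_lt hτ.1, hτ.2⟩)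
  rw [e1] at h
  exact h

end Summit.NavierStokesRegularity.FluidComputer.SobolevLadderSerrin

end
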